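import Summits.ResolutionOfSingularities.ResolutionOfSingularities.Theorems.PurelyInseparableDim4PureLeafUnitInScope1113
import Summits.ResolutionOfSingularities.ResolutionOfSingularities.Theorems.PurelyInseparableDim4PureLeafUnitInScope1131
import Summits.ResolutionOfSingularities.ResolutionOfSingularities.Theorems.PurelyInseparableDim4PureLeafUnitInScope1311
import Summits.ResolutionOfSingularities.ResolutionOfSingularities.Theorems.PurelyInseparableDim4FlatAbsorbPrep
import HarnessLib
import HarnessLib.Audit.Tags

/-!
# Purely inseparable fourfolds — the unit leaves 1113, 1131, 1311 are in-scope escapable for EVERY BOOKING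
# (cell res-dim4-pi; brick (δ), CONFIGS (2,2) unit-leaf row, in-scope column) [OURS · counted 0 · census corollaries]

Width seat `res-dim4-p-10` (g4).  The first three in-scope certificates (`…PureLeafUnitInScope1113/1131/1311`, p704995 /
p705155 / p705192) state `InScopeStateWins 2` for the booking `(r, exc) = (0, ∅)` only; the later ones carry an `_all` form.
Since the in-scope attractor reads the polynomial only (res-rescue-typ-3's `FlatAbsorb.inScopeStateWins_congr`, p-13's
`…FlatAbsorbPrep`), the three statements extend to every booking — one line each.

Riders: `𝔽₂`-rational replies only; the in-scope game, not the plain game; nothing here proves F4-C(2,2) or resolution of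
singularities in dimension ≥ 4 / characteristic `p`; counted 0; AI kernel work, weaker than expert review.
bears_on: LADDER-RESOLUTION:D157-DOOR2 (res-dim4-pi · brick (δ) · unit-leaf row, in-scope column). Supports
stmt-ResolutionOfSingularities-16155 (helper).
-/

set_option linter.dupNamespace false

noncomputable section

namespace Summit.ResolutionOfSingularities.ResolutionOfSingularities.Theorems.PIDim4

namespace InScopeWinCert

open Literature.AlgebraicGeometry.Resolution
open StepKit

/-- The unit leaf `1113` = `x₀x₁x₂x₃³(1+x₀)` is in-scope escapable over `𝔽₂` for EVERY booking `(r, exc)`.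
[OURS · counted 0 · ‖ K] [folklore] -/
theorem UnitLeaf1113.inScopeStateWins_unitLeaf_1113_all (r : Fin 4 →₀ ℕ) (exc : Finset (Fin 4)) :
    InScopeStateWins 2 (⟨evalT [(![1, 1, 1, 3], 1), (![2, 1, 1, 3], 1)], r, exc⟩ : State (ZMod 2)) :=
  FlatAbsorb.inScopeStateWins_congr UnitLeaf1113.inScopeStateWins_unitLeaf_1113 _ rfl

/-- The unit leaf `1131` = `x₀x₁x₂³x₃(1+x₀)` is in-scope escapable over `𝔽₂` for EVERY booking `(r, exc)`.
[OURS · counted 0 · ‖ K] [folklore] -/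
theorem UnitLeaf1131.inScopeStateWins_unitLeaf_1131_all (r : Fin 4 →₀ ℕ) (exc : Finset (Fin 4)) :
    InScopeStateWins 2 (⟨evalT [(![1, 1, 3, 1], 1), (![2, 1, 3, 1], 1)], r, exc⟩ : State (ZMod 2)) :=
  FlatAbsorb.inScopeStateWins_congr UnitLeaf1131.inScopeStateWins_unitLeaf_1131 _ rfl

/-- The unit leaf `1311` = `x₀x₁³x₂x₃(1+x₀)` is in-scope escapable over `𝔽₂` for EVERY booking `(r, exc)`.
[OURS · counted 0 · ‖ K] [folklore] -/
theorem UnitLeaf1311.inScopeStateWins_unitLeaf_1311_all (r : Fin 4 →₀ ℕ) (exc : Finset (Fin 4)) :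
    InScopeStateWins 2 (⟨evalT [(![1, 3, 1, 1], 1), (![2, 3, 1, 1], 1)], r, exc⟩ : State (ZMod 2)) :=
  FlatAbsorb.inScopeStateWins_congr UnitLeaf1311.inScopeStateWins_unitLeaf_1311 _ rfl

end InScopeWinCert

end Summit.ResolutionOfSingularities.ResolutionOfSingularities.Theorems.PIDim4

end
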